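import Mathlib
import HarnessLib
import Summits.FinalStateConjecture.FinalStateConjecture.Theses.StarvedNecks
import Summits.FinalStateConjecture.FinalStateConjecture.Theorems.StarvedNecksFutureOrientedOfSeamedStubPointwiseDeviation
import Summits.FinalStateConjecture.FinalStateConjecture.Theorems.StarvedNecksFutureOrientedOfSeamedStubNormSqTimeVector
import Summits.FinalStateConjecture.FinalStateConjecture.Theorems.StarvedNecksFutureOrientedOfSeamedStubConeTimelike
import Summits.FinalStateConjecture.FinalStateConjecture.Theorems.StarvedNecksFutureOrientedOfSeamedStubConeHandshake
import Summits.FinalStateConjecture.FinalStateConjecture.Theorems.StarvedNecksFutureOrientedOfSeamedStubOneSign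
import Summits.FinalStateConjecture.FinalStateConjecture.Theorems.StarvedNecksFutureOrientedOfSeamedStubRay
import Summits.FinalStateConjecture.FinalStateConjecture.Theorems.StarvedNecksFutureOrientedOfSeamedStubContinuousW
import Literature.Geometry.Lorentzian.BackgroundChartCalculusFramed
import Literature.Geometry.Lorentzian.KerrSchildCoord
import Literature.Geometry.Lorentzian.KerrWaveEnergy

/-!
# Route StarvedNecks — crux `FutureOrientedOfSeamed` (stmt-FinalStateConjecture-17576) PROVED
# (line `Sketch`, idea `clock-duality-rays`)

`Summit.FinalStateConjecture.FinalStateConjecture.Theses.StarvedNecks.FutureOrientedOfSeamed`: for every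
admissible datum, MGHD `𝒟`, region `O`, `C²` decomposition `d` of `O`, radii `R`, `R₀`:
`O = exteriorOf 𝒟 d.charted`, HonestCore`(d, R₀)` and SEAMED`(d, R, R₀)` imply `IsFutureOriented d`.

Composition (`FutureOrientedOfSeamed_of`, the registered skeleton of the line with its seven stubs landed): clauses (i) (orthochronous motions) and (iii) (flat `∂₀`
future-directed on late flat slabs) are HonestCore (a) and (d) verbatim; clause (ii) is the chart-local
transfer `slabOrientationFromAnchor` (C⁺ of the idea card), fed by Hc (a) (`100 M ≤ R₀`,
sub-extremality), Sm (1) (`R₀ + 4 ≤ Rᵢ`) and Sm (5) (the anchor `dΨᵢ(Λᵢe₀)` future-directed on the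
certified band, in particular on the sphere `{rᵢ = R₀}`), and the structure's fixed-radius convergence
lowered from `k = 2` to `k = 0`.

`slabOrientationFromAnchor` (one smooth chart `Ψ` on one boosted Kerr background `B`): fix `ρ`, put
`ρ' := max ρ R₀`, `K := ‖Λ‖²`, `δ := 1/(20 K)`. Eventually in `τ` the `C⁰` deviation on the truncated
slab `{t* = τ, r ≤ ρ'}` is `< δ` and `τ ≥ T`. Then: (1) pointwise `‖(Ψ^*g − g_B)(z)‖ ≤ δ` on that slab
(`stub_pointwiseDeviation`); (2) the transported field `W(y) = Λ V_{M,a}(Λ⁻¹(y − c))` has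
`g_B(W, W) = −1 − 2H ≤ −1` and `‖W‖² ≤ 13 K` (`stub_normSq_timeVector`, `H ≤ M/r ≤ 1`), so `dΨ(W)` is
timelike on the slab (`stub_coneTimelike`); (3) at an anchor point `y` (`r(ŷ) = R₀ ≥ 100 M`, `t*(ŷ) = τ`)
clock duality `g_B(Λe₀, W) = g_{M,a}(e₀, V) = −1` and `g_B(Λe₀, Λe₀) = −1 + 2H(ŷ) ≤ −0.98` hand the
orientation of `dΨ(Λe₀)` (Sm (5)) to `dΨ(W y)` (`stub_coneHandshake`); (4) every slab point `x` is joined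
to such an anchor point by a preconnected set `S ⊆ {t* = τ, r ≤ ρ'} ∩ B.domain` — a straight rest-frame
spatial ray segment, on which the Kerr–Schild radius is monotone (`stub_ray`); (5) the one-sign lemma for
the continuous (`stub_continuousW`) variable field `W` on `S` (`stub_oneSign`, subtype form of
`Spacetime.isFutureDirected_mfderiv_apply_of_isPreconnected`) carries the orientation from `y` to `x`.

References: B. O'Neill, *Semi-Riemannian geometry*, Academic Press 1983, Ch. 5, Lemma 5.26 ff., p. 145;
M. Dafermos, I. Rodnianski, arXiv:0811.0354, §5.1 (`V = −∇t*` timelike on `{r > 0}`); M. Visser,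
arXiv:0706.0622, (33)–(35); DHRT arXiv:2104.08222, §1.
-/

noncomputable section

set_option linter.dupNamespace false
-- instance search through nested operator types `E4 →L[ℝ] E4 →L[ℝ] ℝ`
set_option maxSynthPendingDepth 3

open Set Filter Topology Function
open scoped Manifold ContDiff ENNReal Topology
open Literature.Geometry.Lorentzian

namespace Summit.FinalStateConjecture.FinalStateConjecture.Theorems.FutureOrientedOfSeamed.ClockDualityRays

/-! ## The seven bricks (landed `--supports` files, same namespace)

`stub_pointwiseDeviation` (pointwise `C⁰` extraction), `stub_normSq_timeVector` (`‖V‖² ≤ 13`),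
`stub_coneTimelike`, `stub_coneHandshake` (pointwise cone algebra), `stub_oneSign` (one sign of a variable
causal field on a preconnected coordinate set, subtype charts), `stub_ray` (rest-frame rays reach the anchor
sphere inside the slab), `stub_continuousW` (continuity of the transported time field) — imported above. -/

/-! ## A Kerr–Schild one-liner used by the composition -/

/-- `H ≤ 1` on the chart domain `{r > max r₊ 0}` for `0 ≤ M` (`H ≤ M/r`, `r > r₊ ≥ M`).
Visser arXiv:0706.0622, (33). [folklore] -/
theorem scalarH_le_one {M a : ℝ} (hM : 0 ≤ M) {x : E4} (hx : x ∈ (Kerr.exterior M a : Set E4)) :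
    Kerr.scalarH M a x ≤ 1 := by
  have hr : 0 < Kerr.radius a x := Kerr.radius_pos_of_mem_region hx
  have hrp : Kerr.rPlus M a < Kerr.radius a x := Kerr.lt_radius_of_mem_region hx
  have hMr : M ≤ Kerr.radius a x := by
    have : M ≤ Kerr.rPlus M a := by
      unfold Kerr.rPlus
      linarith [Real.sqrt_nonneg (M ^ 2 - a ^ 2)]
    linarith
  calc Kerr.scalarH M a x ≤ M / Kerr.radius a x := Kerr.scalarH_le_div hM a hr
    _ ≤ 1 := by rw [div_le_one hr]; exact hMr

/-! ## The chart-local transfer C⁺ -/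

/-- `‖Λ‖ > 0` for a Lorentz transformation (`Λ e₀ ≠ 0`). [folklore] -/
theorem norm_lorentz_pos (Λ : lorentzGroup) : 0 < ‖((Λ : E4 ≃L[ℝ] E4) : E4 →L[ℝ] E4)‖ := by
  rcases (norm_nonneg ((Λ : E4 ≃L[ℝ] E4) : E4 →L[ℝ] E4)).lt_or_eq with h | h
  · exact h
  · exfalso
    have h0 : ((Λ : E4 ≃L[ℝ] E4) : E4 →L[ℝ] E4) = 0 := norm_eq_zero.mp h.symm
    have h1 : (Λ : E4 ≃L[ℝ] E4) (E4.basisVector 0) = 0 := by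
      show ((Λ : E4 ≃L[ℝ] E4) : E4 →L[ℝ] E4) (E4.basisVector 0) = 0
      rw [h0]; rfl
    have h2 : (E4.basisVector 0 : E4) = 0 := by
      have h3 := congrArg (Λ : E4 ≃L[ℝ] E4).symm h1
      rw [ContinuousLinearEquiv.symm_apply_apply, map_zero] at h3
      exact h3
    have h3 : (E4.basisVector 0 : E4) 0 = (0 : E4) 0 := by rw [h2]
    simp at h3

/-- On the boosted exterior the transported time field `W = Λ V(Λ⁻¹(z − c))` has
`g_B(z)(W, W) = g_{M,a}(V, V) = −1 − 2H ≤ −1` for `0 ≤ M`. Dafermos–Rodnianski arXiv:0811.0354, §5.1.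
[folklore] -/
theorem boosted_bilin_W_W_le {M : ℝ} (hM : 0 ≤ M) (a : ℝ) (Λ : lorentzGroup) (c : E4)
    (z : (boostedKerrBackground Λ c M a).domain) :
    (boostedKerrBackground Λ c M a).bilin z.1
        ((Λ : E4 ≃L[ℝ] E4) (Kerr.timeVector M a (poincareInv Λ c z.1)))
        ((Λ : E4 ≃L[ℝ] E4) (Kerr.timeVector M a (poincareInv Λ c z.1))) ≤ -1 := by
  have hzr : 0 < Kerr.radius a (poincareInv Λ c z.1) := Kerr.radius_pos_of_mem_region z.2
  show boostedKerrBilin Λ c M a z.1 _ _ ≤ -1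
  rw [boostedKerrBilin_apply, ContinuousLinearEquiv.symm_apply_apply,
    Kerr.bilin_timeVector_timeVector hzr]
  linarith [Kerr.scalarH_nonneg hM a (poincareInv Λ c z.1)]

/-- On the boosted exterior `‖W‖² ≤ 13 ‖Λ‖²` (`‖V‖² ≤ 13` since `H ≤ 1` there). [folklore] -/
theorem boosted_normSq_W_le {M : ℝ} (hM : 0 ≤ M) (a : ℝ) (Λ : lorentzGroup) (c : E4)
    (z : (boostedKerrBackground Λ c M a).domain) :
    ‖(Λ : E4 ≃L[ℝ] E4) (Kerr.timeVector M a (poincareInv Λ c z.1))‖ ^ 2 ≤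
      13 * ‖((Λ : E4 ≃L[ℝ] E4) : E4 →L[ℝ] E4)‖ ^ 2 := by
  have hz : poincareInv Λ c z.1 ∈ (Kerr.exterior M a : Set E4) := z.2
  have hzr : 0 < Kerr.radius a (poincareInv Λ c z.1) := Kerr.radius_pos_of_mem_region hz
  have hV := stub_normSq_timeVector hM hzr (scalarH_le_one hM hz)
  have h1 : ‖(Λ : E4 ≃L[ℝ] E4) (Kerr.timeVector M a (poincareInv Λ c z.1))‖ ≤
      ‖((Λ : E4 ≃L[ℝ] E4) : E4 →L[ℝ] E4)‖ * ‖Kerr.timeVector M a (poincareInv Λ c z.1)‖ :=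
    ((Λ : E4 ≃L[ℝ] E4) : E4 →L[ℝ] E4).le_opNorm _
  calc ‖(Λ : E4 ≃L[ℝ] E4) (Kerr.timeVector M a (poincareInv Λ c z.1))‖ ^ 2
      ≤ (‖((Λ : E4 ≃L[ℝ] E4) : E4 →L[ℝ] E4)‖ * ‖Kerr.timeVector M a (poincareInv Λ c z.1)‖) ^ 2 :=
        pow_le_pow_left₀ (norm_nonneg _) h1 2
    _ = ‖((Λ : E4 ≃L[ℝ] E4) : E4 →L[ℝ] E4)‖ ^ 2 * ‖Kerr.timeVector M a (poincareInv Λ c z.1)‖ ^ 2 := by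
        ring
    _ ≤ ‖((Λ : E4 ≃L[ℝ] E4) : E4 →L[ℝ] E4)‖ ^ 2 * 13 := by gcongr
    _ = 13 * ‖((Λ : E4 ≃L[ℝ] E4) : E4 →L[ℝ] E4)‖ ^ 2 := by ring

/-- `‖Λ e₀‖² ≤ ‖Λ‖²` (`‖e₀‖ = 1`). [folklore] -/
theorem normSq_lorentz_basisVector_le (Λ : lorentzGroup) :
    ‖(Λ : E4 ≃L[ℝ] E4) (E4.basisVector 0)‖ ^ 2 ≤ ‖((Λ : E4 ≃L[ℝ] E4) : E4 →L[ℝ] E4)‖ ^ 2 := by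
  have h1 : ‖(Λ : E4 ≃L[ℝ] E4) (E4.basisVector 0)‖ ≤
      ‖((Λ : E4 ≃L[ℝ] E4) : E4 →L[ℝ] E4)‖ * ‖(E4.basisVector 0 : E4)‖ :=
    ((Λ : E4 ≃L[ℝ] E4) : E4 →L[ℝ] E4).le_opNorm _
  have he : ‖(E4.basisVector 0 : E4)‖ = 1 := by
    simp [E4.basisVector]
  rw [he, mul_one] at h1
  exact pow_le_pow_left₀ (norm_nonneg _) h1 2

/-- **Anchor algebra (clock duality).** At a point `y` of the boosted exterior:
`g_B(Λe₀, Λe₀) = −1 + 2H(ŷ) ≤ −1 + 2M/r(ŷ)` and `g_B(Λe₀, W) = g_{M,a}(e₀, V) = −1`.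
Dafermos–Rodnianski arXiv:0811.0354, §5.1 (`g(V, ·) = −dt*`). [folklore] -/
theorem boosted_anchor_pairings {M : ℝ} (hM : 0 ≤ M) (a : ℝ) (Λ : lorentzGroup) (c : E4)
    (y : (boostedKerrBackground Λ c M a).domain) :
    (boostedKerrBackground Λ c M a).bilin y.1 ((Λ : E4 ≃L[ℝ] E4) (E4.basisVector 0))
        ((Λ : E4 ≃L[ℝ] E4) (E4.basisVector 0)) ≤
      -1 + 2 * (M / Kerr.radius a (poincareInv Λ c y.1)) ∧
    (boostedKerrBackground Λ c M a).bilin y.1 ((Λ : E4 ≃L[ℝ] E4) (E4.basisVector 0))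
        ((Λ : E4 ≃L[ℝ] E4) (Kerr.timeVector M a (poincareInv Λ c y.1))) = -1 := by
  have hyr : 0 < Kerr.radius a (poincareInv Λ c y.1) := Kerr.radius_pos_of_mem_region y.2
  constructor
  · show boostedKerrBilin Λ c M a y.1 _ _ ≤ _
    -- `g_{M,a}(e₀, e₀) = η(e₀, e₀) + 2H ℓ(e₀)² = −1 + 2H` (Visser arXiv:0706.0622, (32)–(34))
    rw [boostedKerrBilin_apply, ContinuousLinearEquiv.symm_apply_apply, Kerr.bilin_apply,
      Kerr.nullCovector_basisVector_zero, Minkowski.bilin_basisVector_zero]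
    nlinarith [Kerr.scalarH_le_div hM a hyr]
  · show boostedKerrBilin Λ c M a y.1 _ _ = -1
    rw [boostedKerrBilin_apply, ContinuousLinearEquiv.symm_apply_apply,
      ContinuousLinearEquiv.symm_apply_apply, Kerr.bilin_symm, Kerr.bilin_timeVector hyr]
    simp

/-- **C⁺ (chart-local transfer; idea `clock-duality-rays`).** For ONE smooth chart `Ψ` from the boosted
sub-extremal Kerr exterior `(M, a, Λ, c)` into ANY spacetime: `C⁰` convergence to the boosted background on
every truncated slab, plus future-directedness of `dΨ(Λe₀)` on the anchor sphere `{r = R₀}` (`100 M ≤ R₀`)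
at all chart times `≥ T`, force clause (ii) of `IsFutureOriented`: for every `ρ`, eventually in `τ`,
`dΨ(Λ V_{M,a}(Λ⁻¹(· − c)))` is future-directed on the truncated slab `{t* = τ, r ≤ ρ}`.
O'Neill 1983, Ch. 5, p. 145; Dafermos–Rodnianski arXiv:0811.0354, §5.1. [folklore] -/
theorem slabOrientationFromAnchor (𝓢 : Spacetime.{0} 4) (M a : ℝ) (Λ : lorentzGroup) (c : E4)
    (Ψ : (boostedKerrBackground Λ c M a).domain → 𝓢.carrier) (R₀ T : ℝ)
    (hM : 0 < M) (hMa : Kerr.IsSubextremal M a) (h100 : 100 * M ≤ R₀)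
    (hΨ : ContMDiff 𝓘(ℝ, E4) (𝓡 4) ∞ Ψ)
    (hconv : ∀ ρ : ℝ, Tendsto (fun τ ↦ 𝓢.truncDeviationCk (boostedKerrBackground Λ c M a) Ψ 0 ρ τ)
      atTop (𝓝 0))
    (hanchor : ∀ x : (boostedKerrBackground Λ c M a).domain,
      T ≤ (boostedKerrBackground Λ c M a).time x.1 →
      (boostedKerrBackground Λ c M a).radius x.1 = R₀ →
      𝓢.timeOrientation.IsFutureDirected
        (mfderiv 𝓘(ℝ, E4) (𝓡 4) Ψ x ((Λ : E4 ≃L[ℝ] E4) (E4.basisVector 0))))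
    (ρ : ℝ) :
    ∀ᶠ τ in atTop, ∀ x ∈ (boostedKerrBackground Λ c M a).truncTimeSlab ρ τ,
      𝓢.timeOrientation.IsFutureDirected
        (mfderiv 𝓘(ℝ, E4) (𝓡 4) Ψ x
          ((Λ : E4 ≃L[ℝ] E4) (Kerr.timeVector M a (poincareInv Λ c (x : E4))))) := by
  have hKpos : 0 < ‖((Λ : E4 ≃L[ℝ] E4) : E4 →L[ℝ] E4)‖ ^ 2 := pow_pos (norm_lorentz_pos Λ) 2
  have hδpos : 0 < 1 / (20 * ‖((Λ : E4 ≃L[ℝ] E4) : E4 →L[ℝ] E4)‖ ^ 2) := by positivity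
  -- eventually: the `C⁰` deviation is `< δ` on the big slab `r ≤ max ρ R₀`, and `τ ≥ T`
  have hev : ∀ᶠ τ in atTop, 𝓢.truncDeviationCk (boostedKerrBackground Λ c M a) Ψ 0 (max ρ R₀) τ <
      ENNReal.ofReal (1 / (20 * ‖((Λ : E4 ≃L[ℝ] E4) : E4 →L[ℝ] E4)‖ ^ 2)) :=
    (hconv (max ρ R₀)).eventually (gt_mem_nhds (by simpa using hδpos))
  filter_upwards [hev, eventually_ge_atTop T] with τ hτ hτT
  intro x hx
  -- (1) pointwise deviation bound on the big slab
  have hslab : ∀ z : (boostedKerrBackground Λ c M a).domain,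
      z ∈ (boostedKerrBackground Λ c M a).truncTimeSlab (max ρ R₀) τ →
      ‖𝓢.deviation (boostedKerrBackground Λ c M a) Ψ z‖ ≤
        1 / (20 * ‖((Λ : E4 ≃L[ℝ] E4) : E4 →L[ℝ] E4)‖ ^ 2) :=
    fun z hz ↦ stub_pointwiseDeviation 𝓢 _ Ψ hδpos.le hτ.le z hz
  -- (2) `dΨ W` timelike on the big slab
  have htl : ∀ z : (boostedKerrBackground Λ c M a).domain,
      z ∈ (boostedKerrBackground Λ c M a).truncTimeSlab (max ρ R₀) τ →
      𝓢.metric.IsTimelike (mfderiv 𝓘(ℝ, E4) (𝓡 4) Ψ z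
        ((Λ : E4 ≃L[ℝ] E4) (Kerr.timeVector M a (poincareInv Λ c z.1)))) := fun z hz ↦
    stub_coneTimelike 𝓢 _ Ψ z _ hKpos (boosted_bilin_W_W_le hM.le a Λ c z)
      (boosted_normSq_W_le hM.le a Λ c z) (hslab z hz)
  -- (4) the ray through `x`
  have h2M : 2 * M < R₀ := by linarith
  have hxt : poincareInv Λ c x.1 0 = τ := hx.1
  have hxr : Kerr.radius a (poincareInv Λ c x.1) ≤ max ρ R₀ := hx.2.trans (le_max_left ρ R₀)
  obtain ⟨S, hSc, hSO, hxS, ⟨y, hyS, hyr⟩, hS⟩ :=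
    stub_ray M a Λ c hM hMa h2M (le_max_right ρ R₀) x.1 x.2 hxt hxr
  have hSslab : ∀ z : (boostedKerrBackground Λ c M a).domain, (z : E4) ∈ S →
      z ∈ (boostedKerrBackground Λ c M a).truncTimeSlab (max ρ R₀) τ := fun z hz ↦ hS z hz
  -- (3) the anchor point `y`
  have hyO : y ∈ ((boostedKerrBackground Λ c M a).domain : Set E4) := hSO hyS
  have hR₀ : 0 < R₀ := by linarith
  have hA : 𝓢.timeOrientation.IsFutureDirected
      (mfderiv 𝓘(ℝ, E4) (𝓡 4) Ψ ⟨y, hyO⟩ ((Λ : E4 ≃L[ℝ] E4) (E4.basisVector 0))) := by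
    refine hanchor ⟨y, hyO⟩ ?_ hyr
    show T ≤ poincareInv Λ c y 0
    rw [(hS y hyS).1]
    exact hτT
  obtain ⟨hAA', hAW⟩ := boosted_anchor_pairings hM.le a Λ c ⟨y, hyO⟩
  have hAA : (boostedKerrBackground Λ c M a).bilin y ((Λ : E4 ≃L[ℝ] E4) (E4.basisVector 0))
      ((Λ : E4 ≃L[ℝ] E4) (E4.basisVector 0)) ≤ -(1 / 2) := by
    have hyr' : Kerr.radius a (poincareInv Λ c y) = R₀ := hyr
    rw [hyr'] at hAA'
    have h4 : M / R₀ ≤ 1 / 100 := by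
      rw [div_le_div_iff₀ hR₀ (by norm_num : (0 : ℝ) < 100)]
      linarith
    exact hAA'.trans (by linarith)
  have hfdY : 𝓢.timeOrientation.IsFutureDirected (mfderiv 𝓘(ℝ, E4) (𝓡 4) Ψ ⟨y, hyO⟩
      ((Λ : E4 ≃L[ℝ] E4) (Kerr.timeVector M a (poincareInv Λ c y)))) :=
    stub_coneHandshake 𝓢 _ Ψ ⟨y, hyO⟩ _ _ hKpos hA hAA (normSq_lorentz_basisVector_le Λ) hAW
      (boosted_normSq_W_le hM.le a Λ c ⟨y, hyO⟩) (htl ⟨y, hyO⟩ (hSslab ⟨y, hyO⟩ hyS)).isCausal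
      (hslab ⟨y, hyO⟩ (hSslab ⟨y, hyO⟩ hyS))
  -- (5) propagate along `S`
  exact stub_oneSign 𝓢 (boostedKerrBackground Λ c M a) Ψ hΨ
    (fun w : E4 ↦ (Λ : E4 ≃L[ℝ] E4) (Kerr.timeVector M a (poincareInv Λ c w)))
    (stub_continuousW M a Λ c) hSc hSO (fun z hz ↦ (htl z (hSslab z hz)).isCausal) ⟨y, hyO⟩ hyS
    hfdY x hxS

/-- `truncDeviationCk` is monotone in the derivative order `k` (`supCkENorm_mono_right`).
DHRT arXiv:2104.08222, §1. [folklore] -/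
theorem truncDeviationCk_mono_k (𝓢 : Spacetime.{0} 4) (B : ModelBackground) (Ψ : B.domain → 𝓢.carrier)
    {k k' : ℕ} (h : k ≤ k') (R τ : ℝ) :
    𝓢.truncDeviationCk B Ψ k R τ ≤ 𝓢.truncDeviationCk B Ψ k' R τ := by
  unfold Spacetime.truncDeviationCk
  exact supCkENorm_mono_right _ h _

/-! ## The composition: C⁺ ⇒ the crux -/

/-- **`FutureOrientedOfSeamed` (crux of route StarvedNecks, rank 5) .** For every admissible
datum, MGHD `𝒟`, region `O`, `C²` decomposition `d` of `O`, radii `R`, `R₀`: `O = exteriorOf 𝒟 d.charted`,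
HonestCore and SEAMED imply `IsFutureOriented d` — clause (i) is Hc (a), clause (iii) is Hc (d) on every
flat slab `τ > τ₀`, clause (ii) is `slabOrientationFromAnchor` for the chart of hole `i`, anchored by
Sm (5) on the sphere `{rᵢ = R₀}` (certified since `R₀ + 4 ≤ Rᵢ`, Sm (1)), with the structure's
fixed-radius `C²` convergence lowered to `C⁰`. (Composition adapted from the crux-ideate sketch
`Cruxes/FutureOrientedOfSeamed/SketchIdeator2.lean`.) O'Neill 1983, Ch. 5, p. 145;
Dafermos–Rodnianski arXiv:0811.0354, §5.1. [folklore] -/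
theorem FutureOrientedOfSeamed_of :
    _root_.Summit.FinalStateConjecture.FinalStateConjecture.Theses.StarvedNecks.FutureOrientedOfSeamed := by
  dsimp only [Summit.FinalStateConjecture.FinalStateConjecture.Theses.StarvedNecks.FutureOrientedOfSeamed]
  intro X _ _ _ _ D _ 𝒟 _ O d R R₀ _ hc hs
  obtain ⟨ha, -, -, hd⟩ := hc
  obtain ⟨h1, -, -, -, h5, -⟩ := hs
  refine ⟨fun i ↦ (ha i).2.2, fun i ρ ↦ ?_, ?_⟩
  · -- clause (ii): the chart-local transfer, anchored on the sphere `r = R₀` by Sm (5)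
    have hconv : ∀ ρ' : ℝ, Tendsto (fun τ ↦ 𝒟.toSpacetime.truncDeviationCk
        (boostedKerrBackground (d.motion i).1 (d.motion i).2 (d.mass i) (d.spin i)) (d.chart i) 0 ρ' τ)
        atTop (𝓝 0) := fun ρ' ↦
      tendsto_of_tendsto_of_tendsto_of_le_of_le tendsto_const_nhds (d.tendsto_truncDeviationCk i ρ')
        (fun _ ↦ zero_le) (fun τ ↦ truncDeviationCk_mono_k _ _ _ (Nat.zero_le 2) _ _)
    have hanchor : ∀ x : (boostedKerrBackground (d.motion i).1 (d.motion i).2 (d.mass i) (d.spin i)).domain,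
        d.τ₀ ≤ (boostedKerrBackground (d.motion i).1 (d.motion i).2 (d.mass i) (d.spin i)).time x.1 →
        (boostedKerrBackground (d.motion i).1 (d.motion i).2 (d.mass i) (d.spin i)).radius x.1 = R₀ →
        𝒟.toSpacetime.timeOrientation.IsFutureDirected
          (mfderiv 𝓘(ℝ, E4) (𝓡 4) (d.chart i) x (((d.motion i).1 : E4 ≃L[ℝ] E4) (E4.basisVector 0))) := by
      intro x hT hr
      refine h5 i x (Or.inl hT) (ge_of_eq hr) ?_
      have h14 := ((h1 i).2.2 ((d.background i).time x.1)).1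
      show (d.background i).radius x.1 ≤ R i ((d.background i).time x.1)
      have hr' : (d.background i).radius x.1 = R₀ := hr
      rw [hr']
      linarith
    exact slabOrientationFromAnchor 𝒟.toSpacetime (d.mass i) (d.spin i) (d.motion i).1 (d.motion i).2
      (d.chart i) R₀ d.τ₀ (d.mass_pos i) (ha i).1 (ha i).2.1 (d.isLateChart i).contMDiff hconv hanchor ρ
  · -- clause (iii): Hc (d) on every flat slab `τ > τ₀`
    filter_upwards [eventually_gt_atTop d.τ₀] with τ hτ
    intro x hx
    refine hd x ?_
    have hx0 : (x : E4) 0 = τ := hx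
    rw [hx0]
    exact hτ

end Summit.FinalStateConjecture.FinalStateConjecture.Theorems.FutureOrientedOfSeamed.ClockDualityRays

end
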